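import Mathlib
import Literature.NumberTheory.LFunctions.Zhang2022.Section17SplitPrimeProduct
import Literature.NumberTheory.LFunctions.Zhang2022.Section17NuOneStarMajorant
import Literature.NumberTheory.LFunctions.Zhang2022.Section15Eq1523Edge
import HarnessLib

/-!
# Zhang (2022) §17 p. 98 (u021, remainder `R₁`): the two outer counts in `𝔞`-currency
# `Σ_{l<D⁴} ν(l)(τ₂ ∗ |μχ∗1|)(l)/l ≤ C(𝔞+1)(D/φ(D))³`, `Σ_{l<D⁴} ν(l)τ₆(l)/l ≤ C(𝔞+1)³(D/φ(D))⁶` under (A)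

Topic `Literature/NumberTheory/LFunctions/Zhang2022` (Landau–Siegel audit tree; verdict-neutral).
Y. Zhang, *Discrete mean estimates and the Landau–Siegel zero*, arXiv:2211.02515v1 (2022)
[Zhang2022LandauSiegel] — **an unrefereed manuscript under adjudication; nothing in this file asserts or
denies its Theorems 1–2, and no claim about Landau–Siegel zeros is made.** ZHANG-L discharge lane, WP16,
leaf `Typed.Section17.Eq17_9RelE e1ppD c′`, sub-leaf `R₁` of `Typed.Section17.Step17_u021Chi` (§17 p. 98,
tex L4825: "we can drop the terms with `m₂ > 1` … with an acceptable error" — no bound in print; reading of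
record RT16-int-4 and RT16-int-5: the RELATIVE currency `≤ ε·(𝔞 + 1)` under (A)). Piece **A1** of the owner's cut
«m₁ inside» (HOME/libB/zl-libB-p6/R1-NODE.md): the OUTER `l`-COUNTS.

After the `m₁`-sum (piece M1) and the `m₂`-sum over small arguments (piece M2s,
`Section17U021ChiR1SmallArgs`), the small-argument part of `R₁` is summed against the outer weights
`ν(l)/l · Σ_{l=q₁q₂} τ₂(q₁)·(‖(μχ∗1)(q₂)‖ resp. τ₄(q₂))`, `l < D⁴`, i.e. against the two multiplicative
majorants `F₁ = |ν|·(τ₂ ∗ |μχ ∗ 1|)` and `F₂ = |ν|·(τ₂ ∗ τ₄) = |ν|·τ₆` of `Section17NuOneStarMajorant`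
(there counted ABSOLUTELY: `≤ M₁(log X)⁴`, `≤ M₂(log X)¹²`). Their prime values are
`F₁(p) = |1+χ(p)|(2+|1−χ(p)|) = 4, 0, 3` and `F₂(p) = 6|1+χ(p)| = 12, 0, 6` at `χ(p) = 1, −1, 0`: ALL the
logarithms come from the split primes `χ(p) = 1`, and those are paid for by the leaf's own main constant
`𝔞` through `Section17SplitPrimeProduct.prod_splitPrimes_le_frakA` (`∏_{p<D⁴, χ(p)=1}(1+4/p) ≤ C(𝔞+1)`
under (A)); the ramified primes `p ∣ D` give the factor `(D/φ(D))^{F(p)}`. THIS FILE proves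

* the ENGINE `isBlock_sum_div_le_frakA_pow`: for a majorant block `g` (`MeanSquareMajorant.IsBlock g d`)
  with `g(p) ≤ 4a` at split, `g(p) ≤ 0` at inert and `g(p) ≤ b` at ramified primes,
  `Σ_{1≤l<D⁴} g(l)/l ≤ C·(𝔞+1)^a·(D/φ(D))^b` for all large `D` under (A), `C = C(d,a,b)`
  (Hall–Tenenbaum with the prime sum left free, `MeanSquareMajorant.sum_div_le_exp_sum`;
  `e^{4/p} ≤ (1+4/p)e^{16/p²}`; `e^{Σ_{p∣D}1/p} ≤ D/φ(D)`);
* **(A1a)** `sum_nu_tau_moebiusChi_div_le_frakA`: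
  `Σ_{l∈[1,D⁴)} ‖ν(l)‖/l · Σ_{q₁q₂=l} τ(q₁)‖Σ_{d∣q₂} μ(d)χ(d)‖ ≤ C(𝔞+1)(D/φ(D))³`;
* **(A1b)** `sum_nu_tau_tau4_div_le_frakA_cube`:
  `Σ_{l∈[1,D⁴)} ‖ν(l)‖/l · Σ_{q₁q₂=l} τ(q₁)τ₄(q₂) ≤ C(𝔞+1)³(D/φ(D))⁶`,

both in the shape the owner's small-part assembly consumes (hypotheses bound verbatim); §6 adds the
`τ₆` form `Σ_{l∈[1,D⁴)} ‖ν(l)‖τ₆(l)/l ≤ C(𝔞+1)³(D/φ(D))⁶` (`sum_nu_tau6_div_le_frakA_cube`, imported by the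
large-composite piece for the prime powers `m₂ = p^j`) and, by the tree's
`Ded1524.self_div_totient_le_two_mul_loglog` (`D/φ(D) ≤ 2 log 𝓛`), the same three counts with
`(log 𝓛)^k` in place of `(D/φ(D))^k` (`…_loglog`); §7 adds the SQUARE count (A1c) of the prime-window
piece, `Σ_{l∈[1,D⁴)} ‖ν(l)‖/l · Σ_{q₁q₂=l} τ(q₁)τ(q₂) ≤ C(𝔞+1)²(D/φ(D))⁴ ≤ C′(𝔞+1)²𝓛`
(`sum_nu_tau_tau_div_le_frakA_sq`, `…_sq_ell`, `sum_nu_tau4_div_le_frakA_sq`).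

Theorems only; no definitions, no named facts; standard axioms.

## References

* Y. Zhang, arXiv:2211.02515v1 (2022), §17 p. 98 (u021), Lemma 17.1 p. 96; §2 (2.31); §3 (3.1).
  [cite: Zhang2022LandauSiegel, §17 u021 p.98]
* R. R. Hall, G. Tenenbaum, *Divisors*, CUP 1988, (0.4). [cite: HallTenenbaum1988, (0.4)]
-/

noncomputable section

open Real Finset ArithmeticFunction

namespace Literature.NumberTheory.LFunctions.Zhang2022.Typed.Section17

open Literature.NumberTheory.LFunctions.Zhang2022
open Literature.NumberTheory.LFunctions.Zhang2022.Skeleton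
open Literature.NumberTheory.LFunctions.Zhang2022.MeanSquareMajorant
open Literature.NumberTheory.LFunctions.Zhang2022.Phi3Eval

/-! ## §1. Elementary exponential inequalities -/

/-- `e^x ≤ (1 + x)·e^{x²}` for `x ≥ 0` (`log(1+x) ≥ x/(1+x) ≥ x − x²`). [folklore] -/
private theorem exp_le_one_add_mul_exp_sq {x : ℝ} (hx : 0 ≤ x) :
    Real.exp x ≤ (1 + x) * Real.exp (x ^ 2) := by
  have h1 : 0 < 1 + x := by linarith
  have hlog : x - x ^ 2 ≤ Real.log (1 + x) := by
    have h := Real.one_sub_inv_le_log_of_pos h1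
    have h2 : x - x ^ 2 ≤ 1 - (1 + x)⁻¹ := by
      have h3 : 1 - (1 + x)⁻¹ = x / (1 + x) := by field_simp; ring
      rw [h3, le_div_iff₀ h1]
      nlinarith [sq_nonneg x, mul_nonneg hx (sq_nonneg x)]
    linarith
  calc Real.exp x = Real.exp (x - x ^ 2) * Real.exp (x ^ 2) := by
        rw [← Real.exp_add]; ring_nf
    _ ≤ (1 + x) * Real.exp (x ^ 2) := by
        apply mul_le_mul_of_nonneg_right _ (Real.exp_pos _).le
        calc Real.exp (x - x ^ 2) ≤ Real.exp (Real.log (1 + x)) := Real.exp_le_exp.mpr hlog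
          _ = 1 + x := Real.exp_log h1

/-- For a set `S` of primes: `exp(4Σ_{p∈S} 1/p) ≤ e¹⁶·∏_{p∈S}(1 + 4/p)`
(`e^{4/p} ≤ (1+4/p)e^{16/p²}`, `Σ_p 16/p² ≤ 16Σ_p 1/(p(p−1)) ≤ 16`). [folklore] -/
private theorem exp_four_mul_sum_inv_le {S : Finset ℕ} {N : ℕ} (hS : S ⊆ Nat.primesLE N) :
    Real.exp (4 * ∑ p ∈ S, (p : ℝ)⁻¹) ≤ Real.exp 16 * ∏ p ∈ S, (1 + 4 / (p : ℝ)) := by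
  have hSp : ∀ p ∈ S, p.Prime := fun p hp => (Nat.mem_primesLE.1 (hS hp)).2
  rw [Finset.mul_sum, Real.exp_sum]
  have hterm : ∀ p ∈ S, Real.exp (4 * (p : ℝ)⁻¹) ≤ (1 + 4 / (p : ℝ)) * Real.exp ((4 / (p : ℝ)) ^ 2) := by
    intro p _
    rw [← div_eq_mul_inv]
    exact exp_le_one_add_mul_exp_sq (by positivity)
  have h16 : ∑ p ∈ S, (4 / (p : ℝ)) ^ 2 ≤ 16 := by
    calc ∑ p ∈ S, (4 / (p : ℝ)) ^ 2 = 16 * ∑ p ∈ S, (1 : ℝ) / ((p : ℝ) * p) := by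
          rw [Finset.mul_sum]
          refine Finset.sum_congr rfl fun p hp => ?_
          have hp0 : (p : ℝ) ≠ 0 := by exact_mod_cast (hSp p hp).ne_zero
          field_simp
          ring
      _ ≤ 16 * ∑ p ∈ Nat.primesLE N, (1 : ℝ) / (p * (p - 1)) := by
          refine mul_le_mul_of_nonneg_left ?_ (by norm_num)
          calc ∑ p ∈ S, (1 : ℝ) / ((p : ℝ) * p) ≤ ∑ p ∈ S, (1 : ℝ) / (p * (p - 1)) :=
                Finset.sum_le_sum fun p hp => by
                  have hp2 : (2 : ℝ) ≤ p := by exact_mod_cast (hSp p hp).two_le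
                  exact one_div_le_one_div_of_le (by nlinarith) (by nlinarith)
            _ ≤ ∑ p ∈ Nat.primesLE N, (1 : ℝ) / (p * (p - 1)) :=
                Finset.sum_le_sum_of_subset_of_nonneg hS fun p hp _ => by
                  have hp2 : (2 : ℝ) ≤ p := by exact_mod_cast (Nat.mem_primesLE.1 hp).2.two_le
                  exact div_nonneg zero_le_one (by nlinarith)
      _ ≤ 16 * 1 := mul_le_mul_of_nonneg_left (MertensBound.sum_inv_prime_mul_pred_le_one N) (by norm_num)
      _ = 16 := mul_one _
  have hprod0 : 0 ≤ ∏ p ∈ S, (1 + 4 / (p : ℝ)) := Finset.prod_nonneg fun p _ => by positivity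
  calc ∏ p ∈ S, Real.exp (4 * (p : ℝ)⁻¹)
      ≤ ∏ p ∈ S, ((1 + 4 / (p : ℝ)) * Real.exp ((4 / (p : ℝ)) ^ 2)) :=
        Finset.prod_le_prod (fun p _ => (Real.exp_pos _).le) hterm
    _ = (∏ p ∈ S, (1 + 4 / (p : ℝ))) * Real.exp (∑ p ∈ S, (4 / (p : ℝ)) ^ 2) := by
        rw [Finset.prod_mul_distrib, Real.exp_sum]
    _ ≤ (∏ p ∈ S, (1 + 4 / (p : ℝ))) * Real.exp 16 :=
        mul_le_mul_of_nonneg_left (Real.exp_le_exp.mpr h16) hprod0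
    _ = Real.exp 16 * ∏ p ∈ S, (1 + 4 / (p : ℝ)) := mul_comm _ _

/-- **Euler's product against the exponential**: `exp(Σ_{p∣m} 1/p) ≤ m/φ(m)` for `m ≥ 1`
(`m/φ(m) = ∏_{p∣m}(1 − 1/p)⁻¹`, `e^{1/p}(1 − 1/p) ≤ 1`). [folklore] -/
-- adapted from the (private) lemma of `Section17U021ChiR1M1Sum` (zl-w11-p3), same tree
private theorem exp_sum_inv_primeFactors_le_self_div_totient {m : ℕ} (hm : m ≠ 0) :
    Real.exp (∑ p ∈ m.primeFactors, (p : ℝ)⁻¹) ≤ (m : ℝ) / m.totient := by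
  have hφ : (m.totient : ℝ) = m * ∏ p ∈ m.primeFactors, (1 - 1 / (p : ℝ)) :=
    MertensBound.totient_eq_mul_prod_one_sub_inv m
  have hfac : ∀ p ∈ m.primeFactors, 0 < 1 - 1 / (p : ℝ) := fun p hp => by
    have hp2 : (2 : ℝ) ≤ p := by exact_mod_cast (Nat.prime_of_mem_primeFactors hp).two_le
    have : 1 / (p : ℝ) ≤ 1 / 2 := one_div_le_one_div_of_le (by norm_num) hp2
    linarith
  have hprod_pos : 0 < ∏ p ∈ m.primeFactors, (1 - 1 / (p : ℝ)) := Finset.prod_pos hfac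
  have hm0 : (0 : ℝ) < m := by exact_mod_cast Nat.pos_of_ne_zero hm
  have hdiv : (m : ℝ) / m.totient = (∏ p ∈ m.primeFactors, (1 - 1 / (p : ℝ)))⁻¹ := by
    rw [hφ, div_mul_eq_div_div, div_self hm0.ne', one_div]
  rw [hdiv, Real.exp_sum, ← Finset.prod_inv_distrib]
  refine Finset.prod_le_prod (fun p _ => (Real.exp_pos _).le) fun p hp => ?_
  rw [le_inv_comm₀ (Real.exp_pos _) (hfac p hp), ← Real.exp_neg]
  have := Real.add_one_le_exp (-(p : ℝ)⁻¹)
  rw [one_div]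
  linarith

/-! ## §2. Character values at primes -/

variable {D : ℕ} (χ : DirichletCharacter ℂ D)

/-- A prime at which `χ` vanishes divides the modulus (`χ` does not vanish on units). [folklore] -/
private theorem dvd_of_apply_prime_eq_zero {p : ℕ} (hp : p.Prime) (h0 : χ (p : ZMod D) = 0) : p ∣ D := by
  by_contra hnd
  exact (((ZMod.isUnit_prime_iff_not_dvd hp).mpr hnd).map χ).ne_zero h0

/-! ## §3. The engine: a block's logarithmic mean in `𝔞`-currency -/

/-- **ENGINE.** Let `g` be a majorant block of degree `d` (`g ≥ 0` multiplicative, `g(p^i) ≤ (i+1)^d`)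
whose prime values satisfy `g(p) ≤ 4a` where `χ(p) = 1`, `g(p) ≤ 0` where `χ(p) = −1` and `g(p) ≤ b`
where `χ(p) = 0`. Then for all large `D`, under (A), `Σ_{1≤l<D⁴} g(l)/l ≤ C·(𝔞+1)^a·(D/φ(D))^b` with
`C = e^{S_d}(e¹⁶C₀)^a` absolute (`C₀` of `prod_splitPrimes_le_frakA`). Route: Hall–Tenenbaum (0.4) with
the prime sum free (`sum_div_le_exp_sum`), the prime sum split by the value of `χ(p)`,
`exp(4Σ_{split}1/p) ≤ e¹⁶∏_{split}(1+4/p) ≤ e¹⁶C₀(𝔞+1)` and `exp(Σ_{p∣D}1/p) ≤ D/φ(D)`.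
[cite: Zhang2022LandauSiegel, §17 u021 p.98; Lemma 17.1 p.96] -/
theorem isBlock_sum_div_le_frakA_pow (d a b : ℕ) : ∃ C : ℝ, ForAllLarge fun D _ χ => AssumptionA D χ →
    ∀ g : ArithmeticFunction ℝ, IsBlock g d →
      (∀ p : ℕ, p.Prime → χ (p : ZMod D) = 1 → g p ≤ 4 * a) →
      (∀ p : ℕ, p.Prime → χ (p : ZMod D) = -1 → g p ≤ 0) →
      (∀ p : ℕ, p.Prime → χ (p : ZMod D) = 0 → g p ≤ b) →
      ∑ l ∈ Finset.Ico 1 (D ^ 4), g l / l ≤ C * (frakA χ + 1) ^ a * ((D : ℝ) / D.totient) ^ b := by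
  classical
  obtain ⟨C₀, D₀, hP⟩ := prod_splitPrimes_le_frakA
  refine ⟨Real.exp (LogEulerProduct.tailConst d) * (Real.exp 16 * C₀) ^ a, D₀,
    fun D _ χ hD hq hp hA g hg h1 hm1 h0 => ?_⟩
  have hprod := hP D χ hD hq hp hA
  have hD0 : D ≠ 0 := NeZero.ne D
  have hD4 : 1 ≤ D ^ 4 := Nat.one_le_pow _ _ (Nat.pos_of_ne_zero hD0)
  -- `[1, D⁴) = [1, X]`, `X = D⁴ − 1`
  set X : ℕ := D ^ 4 - 1 with hXdef
  have hDX : D ^ 4 = X + 1 := (Nat.sub_add_cancel hD4).symm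
  have hIco : Finset.Ico 1 (D ^ 4) = Finset.Icc 1 X := by
    rw [hDX]; exact Finset.Ico_add_one_right_eq_Icc 1 X
  rw [hIco]
  -- Hall–Tenenbaum with the prime sum free
  have hmain := sum_div_le_exp_sum (f := fun n => g n) hg.isMult.map_one
    (fun m n h => hg.isMult.map_mul_of_coprime h) hg.nonneg (fun p ν hp => hg.pow_le p ν hp) X
  -- the two prime sets
  set A : Finset ℕ := (Finset.range (D ^ 4)).filter (fun p : ℕ => p.Prime ∧ χ (p : ZMod D) = 1)
    with hAdef
  set sA : ℝ := ∑ p ∈ A, (p : ℝ)⁻¹ with hsA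
  set sR : ℝ := ∑ p ∈ D.primeFactors, (p : ℝ)⁻¹ with hsR
  -- the prime sum, split by the value of `χ(p)`
  have hprime : ∑ p ∈ Nat.primesLE X, g p / p ≤ 4 * a * sA + b * sR := by
    have hpt : ∀ p ∈ Nat.primesLE X, g p / p ≤
        4 * a * (if p ∈ A then (p : ℝ)⁻¹ else 0) + b * (if p ∈ D.primeFactors then (p : ℝ)⁻¹ else 0) := by
      intro p hpX
      have hpP : p.Prime := (Nat.mem_primesLE.1 hpX).2
      have hple : p ≤ X := (Nat.mem_primesLE.1 hpX).1
      have hp0 : (0 : ℝ) < p := by exact_mod_cast hpP.pos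
      have hi1 : 0 ≤ (if p ∈ A then (p : ℝ)⁻¹ else 0) := by split_ifs <;> positivity
      have hi2 : 0 ≤ (if p ∈ D.primeFactors then (p : ℝ)⁻¹ else 0) := by split_ifs <;> positivity
      rcases hq (p : ZMod D) with h | h | h
      · -- ramified: `χ(p) = 0`, `p ∣ D`
        have hmem : p ∈ D.primeFactors :=
          Nat.mem_primeFactors.mpr ⟨hpP, dvd_of_apply_prime_eq_zero χ hpP h, hD0⟩
        rw [if_pos hmem]
        have : g p / p ≤ b * (p : ℝ)⁻¹ := by
          rw [div_eq_mul_inv]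
          exact mul_le_mul_of_nonneg_right (h0 p hpP h) (inv_nonneg.mpr hp0.le)
        nlinarith
      · -- split: `χ(p) = 1`
        have hmem : p ∈ A := by
          rw [hAdef, Finset.mem_filter, Finset.mem_range]
          exact ⟨by omega, hpP, h⟩
        rw [if_pos hmem]
        have : g p / p ≤ 4 * a * (p : ℝ)⁻¹ := by
          rw [div_eq_mul_inv]
          exact mul_le_mul_of_nonneg_right (h1 p hpP h) (inv_nonneg.mpr hp0.le)
        nlinarith
      · -- inert: `χ(p) = −1`
        have : g p / p ≤ 0 := div_nonpos_of_nonpos_of_nonneg (hm1 p hpP h) hp0.le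
        nlinarith
    calc ∑ p ∈ Nat.primesLE X, g p / p
        ≤ ∑ p ∈ Nat.primesLE X, (4 * a * (if p ∈ A then (p : ℝ)⁻¹ else 0) +
            b * (if p ∈ D.primeFactors then (p : ℝ)⁻¹ else 0)) := Finset.sum_le_sum hpt
      _ = 4 * a * ∑ p ∈ Nat.primesLE X ∩ A, (p : ℝ)⁻¹ +
            b * ∑ p ∈ Nat.primesLE X ∩ D.primeFactors, (p : ℝ)⁻¹ := by
          rw [Finset.sum_add_distrib, ← Finset.mul_sum, ← Finset.mul_sum, Finset.sum_ite_mem,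
            Finset.sum_ite_mem]
      _ ≤ 4 * a * sA + b * sR := by
          gcongr
          · exact Finset.sum_le_sum_of_subset_of_nonneg Finset.inter_subset_right
              fun p _ _ => by positivity
          · exact Finset.sum_le_sum_of_subset_of_nonneg Finset.inter_subset_right
              fun p _ _ => by positivity
  -- the split primes: `exp(4 sA) ≤ e¹⁶ ∏_A (1+4/p) ≤ e¹⁶ C₀ (𝔞+1)`
  have hAsub : A ⊆ Nat.primesLE (D ^ 4) := by
    intro p hpA
    rw [hAdef, Finset.mem_filter, Finset.mem_range] at hpA
    exact Nat.mem_primesLE.mpr ⟨hpA.1.le, hpA.2.1⟩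
  have hsplit : Real.exp (4 * sA) ≤ Real.exp 16 * C₀ * (frakA χ + 1) := by
    calc Real.exp (4 * sA) ≤ Real.exp 16 * ∏ p ∈ A, (1 + 4 / (p : ℝ)) := exp_four_mul_sum_inv_le hAsub
      _ ≤ Real.exp 16 * (C₀ * (frakA χ + 1)) :=
          mul_le_mul_of_nonneg_left hprod (Real.exp_pos _).le
      _ = Real.exp 16 * C₀ * (frakA χ + 1) := by ring
  have hbase : 0 ≤ Real.exp 16 * C₀ * (frakA χ + 1) := le_trans (Real.exp_pos _).le hsplit
  -- the ramified primes
  have hram : Real.exp sR ≤ (D : ℝ) / D.totient := exp_sum_inv_primeFactors_le_self_div_totient hD0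
  -- assembly
  have hexp : Real.exp (∑ p ∈ Nat.primesLE X, g p / p + LogEulerProduct.tailConst d) ≤
      Real.exp (LogEulerProduct.tailConst d) * (Real.exp 16 * C₀) ^ a * (frakA χ + 1) ^ a *
        ((D : ℝ) / D.totient) ^ b := by
    calc Real.exp (∑ p ∈ Nat.primesLE X, g p / p + LogEulerProduct.tailConst d)
        ≤ Real.exp (4 * a * sA + b * sR + LogEulerProduct.tailConst d) :=
          Real.exp_le_exp.mpr (by linarith)
      _ = Real.exp (LogEulerProduct.tailConst d) * Real.exp (4 * sA) ^ a * Real.exp sR ^ b := by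
          rw [show 4 * (a : ℝ) * sA + b * sR + LogEulerProduct.tailConst d =
              LogEulerProduct.tailConst d + (a : ℝ) * (4 * sA) + (b : ℝ) * sR by ring,
            Real.exp_add, Real.exp_add, Real.exp_nat_mul, Real.exp_nat_mul]
      _ ≤ Real.exp (LogEulerProduct.tailConst d) * (Real.exp 16 * C₀ * (frakA χ + 1)) ^ a *
            ((D : ℝ) / D.totient) ^ b := by
          gcongr
      _ = Real.exp (LogEulerProduct.tailConst d) * (Real.exp 16 * C₀) ^ a * (frakA χ + 1) ^ a *
            ((D : ℝ) / D.totient) ^ b := by rw [mul_pow]; ring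
  exact hmain.trans hexp

/-! ## §4. (A1a) The main outer count `F₁ = |ν|·(τ₂ ∗ |μχ ∗ 1|)` -/

/-- The block `F₁ = |ν|·(τ₂ ∗ |μχ∗1|)` evaluates to the owner's weight:
`F₁(l) = ‖ν(l)‖·Σ_{q₁q₂=l} τ(q₁)·‖Σ_{d∣q₂} μ(d)χ(d)‖`. [cite: Zhang2022LandauSiegel, §17 u021 p.98] -/
theorem F1_apply (l : ℕ) :
    ((normAF ((ArithmeticFunction.zeta : ArithmeticFunction ℂ) *
        toArithmeticFunction (fun n : ℕ => χ (n : ZMod D)))).pmul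
      (tau 2 * normAF (((ArithmeticFunction.moebius : ArithmeticFunction ℂ).pmul
        (toArithmeticFunction (fun n : ℕ => χ (n : ZMod D)))) *
          (ArithmeticFunction.zeta : ArithmeticFunction ℂ)))) l =
      ‖nu χ l‖ * ∑ q ∈ l.divisorsAntidiagonal, (q.1.divisors.card : ℝ) *
        ‖∑ d ∈ q.2.divisors, (ArithmeticFunction.moebius d : ℂ) * χ (d : ZMod D)‖ := by
  rw [pmul_apply, normAF_apply, nuAF_apply, mul_apply]
  congr 1
  refine Finset.sum_congr rfl fun q _ => ?_
  rw [tau_two_apply, normAF_apply, coe_mul_zeta_apply]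
  congr 2
  refine Finset.sum_congr rfl fun d hd => ?_
  have hd0 : d ≠ 0 := (Nat.pos_of_mem_divisors hd).ne'
  rw [pmul_apply, intCoe_apply]
  simp only [toArithmeticFunction, ArithmeticFunction.coe_mk, hd0, if_false]

/-- **(A1a) The main outer count in `𝔞`-currency**: for all large `D`, under (A),
`Σ_{l∈[1,D⁴)} ‖ν(l)‖/l · Σ_{q₁q₂=l} τ(q₁)·‖Σ_{d∣q₂} μ(d)χ(d)‖ ≤ C·(𝔞 + 1)·(D/φ(D))³`
(`F₁(p) = 4, 0, 3` at `χ(p) = 1, −1, 0`; engine with `d = 6`, `a = 1`, `b = 3`).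
[cite: Zhang2022LandauSiegel, §17 u021 p.98] -/
theorem sum_nu_tau_moebiusChi_div_le_frakA : ∃ C : ℝ, ForAllLarge fun D _ χ => AssumptionA D χ →
    ∑ l ∈ Finset.Ico 1 (D ^ 4), ‖nu χ l‖ / l *
        ∑ q ∈ l.divisorsAntidiagonal, (q.1.divisors.card : ℝ) *
          ‖∑ d ∈ q.2.divisors, (ArithmeticFunction.moebius d : ℂ) * χ (d : ZMod D)‖ ≤
      C * (frakA χ + 1) * ((D : ℝ) / D.totient) ^ 3 := by
  obtain ⟨C, D₀, h⟩ := isBlock_sum_div_le_frakA_pow 6 1 3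
  refine ⟨C, D₀, fun D _ χ hD hq hp hA => ?_⟩
  have hB := isBlock_pmul (isBlock_normAF_nu χ)
    ((isBlock_tau 2).mul (isBlock_normAF_moebiusChi_mul_zeta χ))
  have hprime : ∀ p : ℕ, p.Prime →
      ((normAF ((ArithmeticFunction.zeta : ArithmeticFunction ℂ) *
          toArithmeticFunction (fun n : ℕ => χ (n : ZMod D)))).pmul
        (tau 2 * normAF (((ArithmeticFunction.moebius : ArithmeticFunction ℂ).pmul
          (toArithmeticFunction (fun n : ℕ => χ (n : ZMod D)))) *
            (ArithmeticFunction.zeta : ArithmeticFunction ℂ)))) p =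
        ‖1 + χ (p : ZMod D)‖ * (2 + ‖1 - χ (p : ZMod D)‖) := by
    intro p hpP
    rw [pmul_apply, normAF_nu_prime χ hpP,
      mul_apply_prime (tau_apply_one 2) (isBlock_normAF_moebiusChi_mul_zeta χ).isMult.map_one hpP,
      tau_prime 2 hpP, normAF_moebiusChi_mul_zeta_prime χ hpP]
    push_cast
    ring
  have key := h D χ hD hq hp hA _ hB
    (fun p hpP hc => by rw [hprime p hpP, hc]; norm_num)
    (fun p hpP hc => by rw [hprime p hpP, hc]; norm_num)
    (fun p hpP hc => by rw [hprime p hpP, hc]; norm_num)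
  rw [pow_one] at key
  refine le_of_eq_of_le (Finset.sum_congr rfl fun l _ => ?_) key
  rw [F1_apply χ l]
  ring

/-! ## §5. (A1b) The perturbation outer count `F₂ = |ν|·τ₆` -/

/-- The block `F₂ = |ν|·τ₆` evaluates to the owner's weight: `F₂(l) = ‖ν(l)‖·Σ_{q₁q₂=l} τ(q₁)τ₄(q₂)`
(`τ₆ = τ₂ ∗ τ₄`). [cite: Zhang2022LandauSiegel, §17 u021 p.98] -/
theorem F2_apply (l : ℕ) :
    ((normAF ((ArithmeticFunction.zeta : ArithmeticFunction ℂ) *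
        toArithmeticFunction (fun n : ℕ => χ (n : ZMod D)))).pmul (tau 6)) l =
      ‖nu χ l‖ * ∑ q ∈ l.divisorsAntidiagonal, (q.1.divisors.card : ℝ) * tau 4 q.2 := by
  rw [pmul_apply, normAF_apply, nuAF_apply, show (6 : ℕ) = 2 + 4 from rfl, tau_add_apply]
  congr 1
  refine Finset.sum_congr rfl fun q _ => ?_
  rw [tau_two_apply]

/-- **(A1b) The perturbation outer count in `𝔞`-currency**: for all large `D`, under (A),
`Σ_{l∈[1,D⁴)} ‖ν(l)‖/l · Σ_{q₁q₂=l} τ(q₁)·τ₄(q₂) ≤ C·(𝔞 + 1)³·(D/φ(D))⁶`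
(`F₂(p) = 6‖1+χ(p)‖ = 12, 0, 6` at `χ(p) = 1, −1, 0`; engine with `d = 8`, `a = 3`, `b = 6`).
[cite: Zhang2022LandauSiegel, §17 u021 p.98] -/
theorem sum_nu_tau_tau4_div_le_frakA_cube : ∃ C : ℝ, ForAllLarge fun D _ χ => AssumptionA D χ →
    ∑ l ∈ Finset.Ico 1 (D ^ 4), ‖nu χ l‖ / l *
        ∑ q ∈ l.divisorsAntidiagonal, (q.1.divisors.card : ℝ) * tau 4 q.2 ≤
      C * (frakA χ + 1) ^ 3 * ((D : ℝ) / D.totient) ^ 6 := by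
  obtain ⟨C, D₀, h⟩ := isBlock_sum_div_le_frakA_pow 8 3 6
  refine ⟨C, D₀, fun D _ χ hD hq hp hA => ?_⟩
  have hB := isBlock_pmul (isBlock_normAF_nu χ) (isBlock_tau 6)
  have hprime : ∀ p : ℕ, p.Prime →
      ((normAF ((ArithmeticFunction.zeta : ArithmeticFunction ℂ) *
          toArithmeticFunction (fun n : ℕ => χ (n : ZMod D)))).pmul (tau 6)) p =
        ‖1 + χ (p : ZMod D)‖ * 6 := by
    intro p hpP
    rw [pmul_apply, normAF_nu_prime χ hpP, tau_prime 6 hpP]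
    push_cast
    ring
  have key := h D χ hD hq hp hA _ hB
    (fun p hpP hc => by rw [hprime p hpP, hc]; norm_num)
    (fun p hpP hc => by rw [hprime p hpP, hc]; norm_num)
    (fun p hpP hc => by rw [hprime p hpP, hc]; norm_num)
  refine le_of_eq_of_le (Finset.sum_congr rfl fun l _ => ?_) key
  rw [F2_apply χ l]
  ring

/-! ## §6. The `τ₆` form and the `log 𝓛` forms of the two counts -/

/-- **(A1b, `τ₆` form)** — the shape the large-composite piece (prime powers `m₂ = p^j`) imports:
for all large `D`, under (A), `Σ_{l∈[1,D⁴)} ‖ν(l)‖τ₆(l)/l ≤ C·(𝔞 + 1)³·(D/φ(D))⁶` (`τ₆ = τ₂ ∗ τ₄`).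
[cite: Zhang2022LandauSiegel, §17 u021 p.98] -/
theorem sum_nu_tau6_div_le_frakA_cube : ∃ C : ℝ, ForAllLarge fun D _ χ => AssumptionA D χ →
    ∑ l ∈ Finset.Ico 1 (D ^ 4), ‖nu χ l‖ * tau 6 l / l ≤
      C * (frakA χ + 1) ^ 3 * ((D : ℝ) / D.totient) ^ 6 := by
  obtain ⟨C, D₀, h⟩ := sum_nu_tau_tau4_div_le_frakA_cube
  refine ⟨C, D₀, fun D _ χ hD hq hp hA => ?_⟩
  refine le_of_eq_of_le (Finset.sum_congr rfl fun l _ => ?_) (h D χ hD hq hp hA)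
  have h2 := F2_apply χ l
  rw [pmul_apply, normAF_apply, nuAF_apply] at h2
  rw [h2]
  ring

/-- `(D/φ(D))^k ≤ 2^k·(log 𝓛)^k` for all large `D` (the tree's `D/φ(D) ≤ 2 log 𝓛`,
`Ded1524.self_div_totient_le_two_mul_loglog`). [cite: HardyWright2008, Thm 328] -/
theorem self_div_totient_pow_le_loglog_pow : ∃ D₁ : ℕ, ∀ D : ℕ, D₁ ≤ D → ∀ k : ℕ,
    ((D : ℝ) / D.totient) ^ k ≤ 2 ^ k * Real.log (ell D) ^ k := by
  obtain ⟨D₁, h₁⟩ := Ded1524.self_div_totient_le_two_mul_loglog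
  refine ⟨D₁, fun D hD k => ?_⟩
  rw [← mul_pow]
  exact pow_le_pow_left₀ (by positivity) (h₁ D hD) k

/-- **(A1a, `log 𝓛` form)**: for all large `D`, under (A),
`Σ_{l∈[1,D⁴)} ‖ν(l)‖/l · Σ_{q₁q₂=l} τ(q₁)·‖Σ_{d∣q₂} μ(d)χ(d)‖ ≤ C·(𝔞 + 1)·(log 𝓛)³`.
[cite: Zhang2022LandauSiegel, §17 u021 p.98] -/
theorem sum_nu_tau_moebiusChi_div_le_frakA_loglog : ∃ C : ℝ, ForAllLarge fun D _ χ => AssumptionA D χ →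
    ∑ l ∈ Finset.Ico 1 (D ^ 4), ‖nu χ l‖ / l *
        ∑ q ∈ l.divisorsAntidiagonal, (q.1.divisors.card : ℝ) *
          ‖∑ d ∈ q.2.divisors, (ArithmeticFunction.moebius d : ℂ) * χ (d : ZMod D)‖ ≤
      C * (frakA χ + 1) * Real.log (ell D) ^ 3 := by
  obtain ⟨C, D₀, h⟩ := sum_nu_tau_moebiusChi_div_le_frakA
  obtain ⟨D₁, h₁⟩ := self_div_totient_pow_le_loglog_pow
  refine ⟨max C 0 * 2 ^ 3, max D₀ D₁, fun D _ χ hD hq hp hA => ?_⟩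
  have key := h D χ (le_trans (le_max_left _ _) hD) hq hp hA
  have hφ := h₁ D (le_trans (le_max_right _ _) hD) 3
  have hA0 : 0 ≤ frakA χ + 1 := by linarith [frakA_nonneg χ]
  have hr0 : 0 ≤ ((D : ℝ) / D.totient) ^ 3 := by positivity
  calc _ ≤ C * (frakA χ + 1) * ((D : ℝ) / D.totient) ^ 3 := key
    _ ≤ max C 0 * (frakA χ + 1) * ((D : ℝ) / D.totient) ^ 3 := by gcongr; exact le_max_left _ _
    _ ≤ max C 0 * (frakA χ + 1) * (2 ^ 3 * Real.log (ell D) ^ 3) :=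
        mul_le_mul_of_nonneg_left hφ (mul_nonneg (le_max_right _ _) hA0)
    _ = max C 0 * 2 ^ 3 * (frakA χ + 1) * Real.log (ell D) ^ 3 := by ring

/-- **(A1b, `log 𝓛` form)**: for all large `D`, under (A),
`Σ_{l∈[1,D⁴)} ‖ν(l)‖/l · Σ_{q₁q₂=l} τ(q₁)·τ₄(q₂) ≤ C·(𝔞 + 1)³·(log 𝓛)⁶`.
[cite: Zhang2022LandauSiegel, §17 u021 p.98] -/
theorem sum_nu_tau_tau4_div_le_frakA_cube_loglog : ∃ C : ℝ, ForAllLarge fun D _ χ => AssumptionA D χ →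
    ∑ l ∈ Finset.Ico 1 (D ^ 4), ‖nu χ l‖ / l *
        ∑ q ∈ l.divisorsAntidiagonal, (q.1.divisors.card : ℝ) * tau 4 q.2 ≤
      C * (frakA χ + 1) ^ 3 * Real.log (ell D) ^ 6 := by
  obtain ⟨C, D₀, h⟩ := sum_nu_tau_tau4_div_le_frakA_cube
  obtain ⟨D₁, h₁⟩ := self_div_totient_pow_le_loglog_pow
  refine ⟨max C 0 * 2 ^ 6, max D₀ D₁, fun D _ χ hD hq hp hA => ?_⟩
  have key := h D χ (le_trans (le_max_left _ _) hD) hq hp hA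
  have hφ := h₁ D (le_trans (le_max_right _ _) hD) 6
  have hA0 : 0 ≤ (frakA χ + 1) ^ 3 := pow_nonneg (by linarith [frakA_nonneg χ]) 3
  have hr0 : 0 ≤ ((D : ℝ) / D.totient) ^ 6 := by positivity
  calc _ ≤ C * (frakA χ + 1) ^ 3 * ((D : ℝ) / D.totient) ^ 6 := key
    _ ≤ max C 0 * (frakA χ + 1) ^ 3 * ((D : ℝ) / D.totient) ^ 6 := by gcongr; exact le_max_left _ _
    _ ≤ max C 0 * (frakA χ + 1) ^ 3 * (2 ^ 6 * Real.log (ell D) ^ 6) :=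
        mul_le_mul_of_nonneg_left hφ (mul_nonneg (le_max_right _ _) hA0)
    _ = max C 0 * 2 ^ 6 * (frakA χ + 1) ^ 3 * Real.log (ell D) ^ 6 := by ring

/-- **(A1b, `τ₆` and `log 𝓛` form)**: for all large `D`, under (A),
`Σ_{l∈[1,D⁴)} ‖ν(l)‖τ₆(l)/l ≤ C·(𝔞 + 1)³·(log 𝓛)⁶`. [cite: Zhang2022LandauSiegel, §17 u021 p.98] -/
theorem sum_nu_tau6_div_le_frakA_cube_loglog : ∃ C : ℝ, ForAllLarge fun D _ χ => AssumptionA D χ →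
    ∑ l ∈ Finset.Ico 1 (D ^ 4), ‖nu χ l‖ * tau 6 l / l ≤
      C * (frakA χ + 1) ^ 3 * Real.log (ell D) ^ 6 := by
  obtain ⟨C, D₀, h⟩ := sum_nu_tau_tau4_div_le_frakA_cube_loglog
  refine ⟨C, D₀, fun D _ χ hD hq hp hA => ?_⟩
  refine le_of_eq_of_le (Finset.sum_congr rfl fun l _ => ?_) (h D χ hD hq hp hA)
  have h2 := F2_apply χ l
  rw [pmul_apply, normAF_apply, nuAF_apply] at h2
  rw [h2]
  ring

/-! ## §7. (A1c) The square count `F₃ = |ν|·(τ₂ ∗ τ₂) = |ν|·τ₄` of the prime-window piece -/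

/-- The block `F₃ = |ν|·τ₄` evaluates to the window piece's weight:
`F₃(l) = ‖ν(l)‖·Σ_{q₁q₂=l} τ(q₁)τ(q₂)` (`τ₄ = τ₂ ∗ τ₂`). [cite: Zhang2022LandauSiegel, §17 u021 p.98] -/
theorem F3_apply (l : ℕ) :
    ((normAF ((ArithmeticFunction.zeta : ArithmeticFunction ℂ) *
        toArithmeticFunction (fun n : ℕ => χ (n : ZMod D)))).pmul (tau 4)) l =
      ‖nu χ l‖ * ∑ q ∈ l.divisorsAntidiagonal, (q.1.divisors.card : ℝ) * q.2.divisors.card := by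
  rw [pmul_apply, normAF_apply, nuAF_apply, show (4 : ℕ) = 2 + 2 from rfl, tau_add_apply]
  congr 1
  refine Finset.sum_congr rfl fun q _ => ?_
  rw [tau_two_apply, tau_two_apply]

/-- **(A1c) The square outer count in `𝔞`-currency** (the `l`-count of the prime-window piece
M2L-p, where `‖ν₁*(q₂p)‖ ≤ 6τ₂(q₂)`): for all large `D`, under (A),
`Σ_{l∈[1,D⁴)} ‖ν(l)‖/l · Σ_{q₁q₂=l} τ(q₁)τ(q₂) ≤ C·(𝔞 + 1)²·(D/φ(D))⁴`
(`F₃(p) = 4‖1+χ(p)‖ = 8, 0, 4` at `χ(p) = 1, −1, 0`; engine with `d = 6`, `a = 2`, `b = 4`).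
[cite: Zhang2022LandauSiegel, §17 u021 p.98] -/
theorem sum_nu_tau_tau_div_le_frakA_sq : ∃ C : ℝ, ForAllLarge fun D _ χ => AssumptionA D χ →
    ∑ l ∈ Finset.Ico 1 (D ^ 4), ‖nu χ l‖ / l *
        ∑ q ∈ l.divisorsAntidiagonal, (q.1.divisors.card : ℝ) * q.2.divisors.card ≤
      C * (frakA χ + 1) ^ 2 * ((D : ℝ) / D.totient) ^ 4 := by
  obtain ⟨C, D₀, h⟩ := isBlock_sum_div_le_frakA_pow 6 2 4
  refine ⟨C, D₀, fun D _ χ hD hq hp hA => ?_⟩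
  have hB := isBlock_pmul (isBlock_normAF_nu χ) (isBlock_tau 4)
  have hprime : ∀ p : ℕ, p.Prime →
      ((normAF ((ArithmeticFunction.zeta : ArithmeticFunction ℂ) *
          toArithmeticFunction (fun n : ℕ => χ (n : ZMod D)))).pmul (tau 4)) p =
        ‖1 + χ (p : ZMod D)‖ * 4 := by
    intro p hpP
    rw [pmul_apply, normAF_nu_prime χ hpP, tau_prime 4 hpP]
    push_cast
    ring
  have key := h D χ hD hq hp hA _ hB
    (fun p hpP hc => by rw [hprime p hpP, hc]; norm_num)
    (fun p hpP hc => by rw [hprime p hpP, hc]; norm_num)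
    (fun p hpP hc => by rw [hprime p hpP, hc]; norm_num)
  refine le_of_eq_of_le (Finset.sum_congr rfl fun l _ => ?_) key
  rw [F3_apply χ l]
  ring

/-- `(D/φ(D))⁴ ≤ 2¹⁶·𝓛` for all large `D` (`D/φ(D) ≤ 2 log 𝓛`, `log 𝓛 ≤ 8𝓛^{1/8}`, `𝓛^{1/2} ≤ 𝓛`).
[cite: HardyWright2008, Thm 328] -/
theorem self_div_totient_pow_four_le_ell : ∃ D₁ : ℕ, ∀ D : ℕ, D₁ ≤ D →
    ((D : ℝ) / D.totient) ^ 4 ≤ 2 ^ 16 * ell D := by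
  obtain ⟨D₁, h₁⟩ := self_div_totient_pow_le_loglog_pow
  refine ⟨max D₁ 3, fun D hD => ?_⟩
  have hφ := h₁ D (le_trans (le_max_left _ _) hD) 4
  have hD3 : (3 : ℝ) ≤ D := by exact_mod_cast le_trans (le_max_right _ _) hD
  have hℓ1 : 1 ≤ ell D := by
    have := Real.log_le_log (by norm_num) hD3
    rw [ell]
    linarith [MertensBound.one_lt_log_three]
  have hℓ0 : 0 ≤ ell D := by linarith
  have hlog0 : 0 ≤ Real.log (ell D) := Real.log_nonneg hℓ1
  -- `log 𝓛 ≤ 8 𝓛^{1/8}`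
  have hlog : Real.log (ell D) ≤ 8 * ell D ^ ((1 : ℝ) / 8) := by
    have := Real.log_le_rpow_div hℓ0 (by norm_num : (0 : ℝ) < 1 / 8)
    linarith [show ell D ^ ((1 : ℝ) / 8) / (1 / 8) = 8 * ell D ^ ((1 : ℝ) / 8) by ring]
  -- `(log 𝓛)⁴ ≤ 8⁴ 𝓛^{1/2} ≤ 8⁴ 𝓛`
  have hpow : Real.log (ell D) ^ 4 ≤ 8 ^ 4 * ell D := by
    calc Real.log (ell D) ^ 4 ≤ (8 * ell D ^ ((1 : ℝ) / 8)) ^ 4 := pow_le_pow_left₀ hlog0 hlog 4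
      _ = 8 ^ 4 * ell D ^ ((1 : ℝ) / 2) := by
          rw [mul_pow, ← Real.rpow_natCast (ell D ^ ((1 : ℝ) / 8)) 4, ← Real.rpow_mul hℓ0]
          norm_num
      _ ≤ 8 ^ 4 * ell D := by
          gcongr
          calc ell D ^ ((1 : ℝ) / 2) ≤ ell D ^ (1 : ℝ) :=
                Real.rpow_le_rpow_of_exponent_le hℓ1 (by norm_num)
            _ = ell D := Real.rpow_one _
  calc ((D : ℝ) / D.totient) ^ 4 ≤ 2 ^ 4 * Real.log (ell D) ^ 4 := hφ
    _ ≤ 2 ^ 4 * (8 ^ 4 * ell D) := by gcongr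
    _ = 2 ^ 16 * ell D := by ring

/-- **(A1c, `𝓛` form — the prime-window piece's hypothesis `hA1c` VERBATIM)**: for all large `D`, under
(A), `Σ_{l∈[1,D⁴)} ‖ν(l)‖/l · Σ_{q₁q₂=l} τ(q₁)τ(q₂) ≤ C·(𝔞 + 1)²·𝓛`.
[cite: Zhang2022LandauSiegel, §17 u021 p.98] -/
theorem sum_nu_tau_tau_div_le_frakA_sq_ell : ∃ C : ℝ, ForAllLarge fun D _ χ => AssumptionA D χ →
    ∑ l ∈ Finset.Ico 1 (D ^ 4), ‖nu χ l‖ / l *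
        ∑ q ∈ l.divisorsAntidiagonal, (q.1.divisors.card : ℝ) * q.2.divisors.card ≤
      C * (frakA χ + 1) ^ 2 * ell D := by
  obtain ⟨C, D₀, h⟩ := sum_nu_tau_tau_div_le_frakA_sq
  obtain ⟨D₁, h₁⟩ := self_div_totient_pow_four_le_ell
  refine ⟨max C 0 * 2 ^ 16, max D₀ D₁, fun D _ χ hD hq hp hA => ?_⟩
  have key := h D χ (le_trans (le_max_left _ _) hD) hq hp hA
  have hφ := h₁ D (le_trans (le_max_right _ _) hD)
  have hA0 : 0 ≤ (frakA χ + 1) ^ 2 := pow_nonneg (by linarith [frakA_nonneg χ]) 2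
  have hr0 : 0 ≤ ((D : ℝ) / D.totient) ^ 4 := by positivity
  calc _ ≤ C * (frakA χ + 1) ^ 2 * ((D : ℝ) / D.totient) ^ 4 := key
    _ ≤ max C 0 * (frakA χ + 1) ^ 2 * ((D : ℝ) / D.totient) ^ 4 := by gcongr; exact le_max_left _ _
    _ ≤ max C 0 * (frakA χ + 1) ^ 2 * (2 ^ 16 * ell D) :=
        mul_le_mul_of_nonneg_left hφ (mul_nonneg (le_max_right _ _) hA0)
    _ = max C 0 * 2 ^ 16 * (frakA χ + 1) ^ 2 * ell D := by ring

/-- **(A1c, `τ₄` form)**: for all large `D`, under (A), `Σ_{l∈[1,D⁴)} ‖ν(l)‖τ₄(l)/l ≤ C·(𝔞 + 1)²·(D/φ(D))⁴`.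
[cite: Zhang2022LandauSiegel, §17 u021 p.98] -/
theorem sum_nu_tau4_div_le_frakA_sq : ∃ C : ℝ, ForAllLarge fun D _ χ => AssumptionA D χ →
    ∑ l ∈ Finset.Ico 1 (D ^ 4), ‖nu χ l‖ * tau 4 l / l ≤
      C * (frakA χ + 1) ^ 2 * ((D : ℝ) / D.totient) ^ 4 := by
  obtain ⟨C, D₀, h⟩ := sum_nu_tau_tau_div_le_frakA_sq
  refine ⟨C, D₀, fun D _ χ hD hq hp hA => ?_⟩
  refine le_of_eq_of_le (Finset.sum_congr rfl fun l _ => ?_) (h D χ hD hq hp hA)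
  have h3 := F3_apply χ l
  rw [pmul_apply, normAF_apply, nuAF_apply] at h3
  rw [h3]
  ring

end Literature.NumberTheory.LFunctions.Zhang2022.Typed.Section17
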